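import Mathlib
import HarnessLib
import Literature.MathematicalPhysics.QuantumLattice.HubbardSpaceTimeCharacters
import Summits.HubbardSuperconductivity.HubbardSuperconductivity.Theorems.KLProgrammeBareVertexPlainCurrency

/-!
# Route `KLProgramme` — ENGINE (stmt-HubbardSuperconductivity-20437 `KLRegimeEngineV17F2`), located candidate #25 «(b)-PLAIN-UV-TAIL», THE CONTROL:
# the time-lattice-LOCAL vertex `hubbardInteractionLocal` (Literature `SectorisedKernelNorm`, Salmhofer 1999 (4.54)–(4.58)) has plain position-space quartic
# kernel `(U/4!)·ε_x⁻³·𝟙[x₀ = x₁ = x₂ = x₃]` and plain pinned currency EXACTLY `|U|/24` — uniformly in `M`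
# (cell gate-hubbard-kl, seat hubbard-kl-k3c2-p2 g33)

Companion of `…BareVertexPlainCurrency` (the tree's integer-truncated `hubbardInteraction`: currency `(|U|/24)·Θ_M`, `Θ_M ∝ (ln M)²`).  Here the SAME currency is
computed for the local vertex `V_loc = (U·ε_x) • Σ_y ψ⁺_{y↑}ψ⁻_{y↑}ψ⁺_{y↓}ψ⁻_{y↓}` (`ψ^c_{y,σ} = psiPos`): by the DUAL plane-wave orthogonality
`Σ_k e^{−is_ck·x} conj(e^{−is_ck·y}) = |Λ|·δ_{x,y}` each leg of the word at `y` localises at `y`, so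
* `klbv_sum_hubbardPlaneWave_mul_conj_dual` — the dual orthogonality (sum over the frequency–momentum label);
* `klbv_psiPos_word_eq_sum` — the position word as a momentum sum of vertex monomials; `klbv_kernel_psiPos_word_vertexLegs` — its quartic kernel at `vertexLegs k`;
* **`klbv_positionKernel_hubbardInteractionLocal_eq`** — `W₄(V_loc)(x) = (U·ε_x·(4!)⁻¹·(βL²)⁻⁴·|Λ|⁴)·𝟙[x₀ = x₃ ∧ x₁ = x₃ ∧ x₂ = x₃]` (`= (U/4!)ε_x⁻³·𝟙`);
* **`klbv_plainCurrency_hubbardInteractionLocal_eq`** — `ε_x³·Σ_{x′ : x′_q = y}‖W₄(V_loc)(x′)‖ = |U|/24` for every pinned leg, point, `L`, `M`, `0 < β`.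
So the dichotomy of #25 is kernel-checked on both sides: STRICT conservation ⇒ `(|U|/24)·Θ_M` (M-divergent trigonometric mass); MODULAR (local) ⇒ `|U|/24`.
Pure algebra on tree definitions; no definitions; nothing asserts any row, (b), (C), K3 or superconductivity.
References: Salmhofer 1999 §4.2.4 (4.54)–(4.63) [cite: Salmhofer1999]; BGM 2006 §2.1 (2.5)–(2.6a) [cite: BenfattoGiulianiMastropietro2006].
-/

noncomputable section

namespace Summit.HubbardSuperconductivity.HubbardSuperconductivity.Theorems.KLRegimeSplit

set_option linter.dupNamespace false -- summit = problem name (single-conjunct summit), D-0017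

open Finset Literature.MathematicalPhysics.QuantumLattice Literature.Probability.LatticeModels GrassmannAlgebra
open scoped ComplexConjugate

variable {L M : ℕ} [NeZero L] [NeZero M]

/-! ## §1 Dual plane-wave orthogonality (sum over the label) -/

/-- For the `ψ⁻` charge: `e^{+ik·x}·conj(e^{+ik·y}) = χ_{(k₀ mod 2M)}(x₀ − y₀)·u(x₀,y₀)·χ_{k⃗}(x⃗ − y⃗)` with the momentum-independent unimodular `u`. -/
theorem klbv_planeWave_one_mul_conj {β : ℝ} (hβ : β ≠ 0) (k : FreqMomentum L M) (x y : SpaceTimeIdx L M) :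
    hubbardPlaneWave L M β 1 k x * conj (hubbardPlaneWave L M β 1 k y) =
      (torusChar (fun _ : Fin 1 => ((k.1 : ℕ) : ZMod (2 * M))) (fun _ : Fin 1 => ((x.1 : ℕ) : ZMod (2 * M)) - ((y.1 : ℕ) : ZMod (2 * M))) *
          Complex.exp (((Real.pi * (1 - 2 * M) * (((x.1 : ℕ) : ℝ) - ((y.1 : ℕ) : ℝ)) / (2 * M) : ℝ) : ℂ) * Complex.I)) *
        torusChar k.2 (x.2 - y.2) := by
  have hconj : ∀ (r : ℝ), conj (Complex.exp (-((r : ℝ) : ℂ) * Complex.I)) = Complex.exp (((r : ℝ) : ℂ) * Complex.I) := fun r => by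
    rw [← Complex.exp_conj, map_mul, map_neg, Complex.conj_ofReal, Complex.conj_I]; ring_nf
  simp only [hubbardPlaneWave, chargeSign, show (1 : Fin 2) ≠ 0 by decide, if_false, neg_one_mul, hconj]
  rw [show (-((-spaceTimePhase L M β k x : ℝ) : ℂ)) = ((spaceTimePhase L M β k x : ℝ) : ℂ) by push_cast; ring, ← Complex.exp_add]
  have hsplit : ((spaceTimePhase L M β k x : ℝ) : ℂ) * Complex.I + ((-spaceTimePhase L M β k y : ℝ) : ℂ) * Complex.I =
      ((matsubaraFreq β M k.1 * (imagTime β M x.1 - imagTime β M y.1) : ℝ) : ℂ) * Complex.I +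
        ((∑ j, latticeMomentum L k.2 j * (((x.2 j).val : ℝ) - ((y.2 j).val : ℝ)) : ℝ) : ℂ) * Complex.I := by
    rw [← add_mul, ← add_mul, ← Complex.ofReal_add, ← Complex.ofReal_add]
    congr 2
    simp only [spaceTimePhase]
    have : ∀ j, latticeMomentum L k.2 j * (((x.2 j).val : ℝ) - ((y.2 j).val : ℝ)) =
        latticeMomentum L k.2 j * ((x.2 j).val : ℝ) - latticeMomentum L k.2 j * ((y.2 j).val : ℝ) := fun j => by ring
    simp only [this, Finset.sum_sub_distrib]
    ring
  rw [hsplit, Complex.exp_add, exp_matsubara_phase_eq hβ, exp_latticeMomentum_phase_eq_torusChar]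

omit [NeZero L] [NeZero M] in
/-- For the `ψ⁺` charge the product is the conjugate of the `ψ⁻` one. -/
theorem klbv_planeWave_zero_mul_conj (β : ℝ) (k : FreqMomentum L M) (x y : SpaceTimeIdx L M) :
    hubbardPlaneWave L M β 0 k x * conj (hubbardPlaneWave L M β 0 k y) =
      conj (hubbardPlaneWave L M β 1 k x * conj (hubbardPlaneWave L M β 1 k y)) := by
  have h01 : ∀ z, hubbardPlaneWave L M β 0 k z = conj (hubbardPlaneWave L M β 1 k z) := by
    intro z
    simp only [hubbardPlaneWave, chargeSign, if_true, show (1 : Fin 2) ≠ 0 by decide, if_false, one_mul, neg_one_mul]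
    rw [← Complex.exp_conj, map_mul, map_neg, Complex.conj_ofReal, Complex.conj_I]
    congr 1
    push_cast
    ring
  rw [h01 x, h01 y, map_mul, Complex.conj_conj]

/-- **Dual orthogonality of the plane waves** (sum over the frequency–momentum label, `β ≠ 0`):
`Σ_k e^{−is_ck·x}·conj(e^{−is_ck·y}) = |Λ|·[x = y]`, `|Λ| = 2M·L²`. -/
theorem klbv_sum_hubbardPlaneWave_mul_conj_dual {β : ℝ} (hβ : β ≠ 0) (c : Fin 2) (x y : SpaceTimeIdx L M) :
    ∑ k : FreqMomentum L M, hubbardPlaneWave L M β c k x * conj (hubbardPlaneWave L M β c k y) =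
      if x = y then (Fintype.card (SpaceTimeIdx L M) : ℂ) else 0 := by
  -- the `ψ⁻` case by characters of the product dual torus
  have hone : ∑ k : FreqMomentum L M, hubbardPlaneWave L M β 1 k x * conj (hubbardPlaneWave L M β 1 k y) =
      if x = y then (Fintype.card (SpaceTimeIdx L M) : ℂ) else 0 := by
    simp_rw [klbv_planeWave_one_mul_conj hβ]
    rw [sum_freqMomentum_eq_sum_prodTorus (fun p : TorusSite 1 (2 * M) × TorusSite 2 L =>
      (torusChar p.1 (fun _ : Fin 1 => ((x.1 : ℕ) : ZMod (2 * M)) - ((y.1 : ℕ) : ZMod (2 * M))) *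
          Complex.exp (((Real.pi * (1 - 2 * M) * (((x.1 : ℕ) : ℝ) - ((y.1 : ℕ) : ℝ)) / (2 * M) : ℝ) : ℂ) * Complex.I)) *
        torusChar p.2 (x.2 - y.2)),
      Fintype.sum_prod_type]
    dsimp only
    rw [← sum_mul_sum, ← sum_mul, sum_torusChar_left, sum_torusChar_left]
    by_cases hxy : x = y
    · subst hxy
      have h0 : (fun _ : Fin 1 => ((x.1 : ℕ) : ZMod (2 * M)) - ((x.1 : ℕ) : ZMod (2 * M))) = 0 := by
        funext i; simp
      rw [h0, if_pos rfl, if_pos rfl, sub_self x.2, if_pos rfl, Fintype.card_prod, Fintype.card_fin, Fintype.card_pi, Fin.prod_const, ZMod.card]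
      simp only [sub_self, mul_zero, zero_div, Complex.ofReal_zero, zero_mul, Complex.exp_zero, mul_one, pow_one]
      push_cast
      ring
    · rw [if_neg hxy]
      by_cases h1 : x.1 = y.1
      · have h2 : x.2 ≠ y.2 := fun h => hxy (Prod.ext h1 h)
        rw [if_neg (sub_ne_zero.mpr h2), mul_zero]
      · have hne : (fun _ : Fin 1 => ((x.1 : ℕ) : ZMod (2 * M)) - ((y.1 : ℕ) : ZMod (2 * M))) ≠ 0 := by
          intro h
          have h0 := congr_fun h 0
          simp only [Pi.zero_apply, sub_eq_zero] at h0
          apply h1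
          have hv := congr_arg ZMod.val h0
          rw [val_natCast_matsubaraIdx, val_natCast_matsubaraIdx] at hv
          exact Fin.ext hv
        rw [if_neg hne, zero_mul, zero_mul]
  obtain rfl | rfl : c = 0 ∨ c = 1 := by fin_cases c <;> simp
  · -- `c = 0`: conjugate of the `c = 1` identity (its right side is real)
    simp_rw [klbv_planeWave_zero_mul_conj]
    rw [← map_sum, hone]
    split_ifs
    · rw [Complex.conj_natCast]
    · rw [map_zero]
  · exact hone

/-! ## §2 The position word `ψ⁺_{y↑}ψ⁻_{y↑}ψ⁺_{y↓}ψ⁻_{y↓}` as a momentum sum, and its quartic kernel -/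

omit [NeZero M] in
/-- Expanding a product of four scalar-weighted generator sums into a sum over label quadruples of vertex monomials. -/
theorem klbv_fourfold_smul_sum (f₀ f₁ f₂ f₃ : FreqMomentum L M → ℂ) :
    (∑ a : FreqMomentum L M, f₀ a • gen ℂ (((a, (0 : Fin 2)), (0 : Fin 2)) : HubbardFieldIdx L M)) *
        (∑ b : FreqMomentum L M, f₁ b • gen ℂ (((b, (0 : Fin 2)), (1 : Fin 2)) : HubbardFieldIdx L M)) *
        (∑ c : FreqMomentum L M, f₂ c • gen ℂ (((c, (1 : Fin 2)), (0 : Fin 2)) : HubbardFieldIdx L M)) *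
        (∑ d : FreqMomentum L M, f₃ d • gen ℂ (((d, (1 : Fin 2)), (1 : Fin 2)) : HubbardFieldIdx L M)) =
      ∑ κ : Fin 4 → FreqMomentum L M, (f₀ (κ 0) * f₁ (κ 1) * f₂ (κ 2) * f₃ (κ 3)) • vertexMonomial L M κ := by
  rw [mul_assoc, mul_assoc]
  simp only [sum_mul]
  simp only [mul_sum]
  simp only [smul_mul_assoc, mul_smul_comm, smul_smul]
  rw [sum_pi_fin_four]
  refine sum_congr rfl fun a _ => sum_congr rfl fun b _ => sum_congr rfl fun c _ => sum_congr rfl fun d _ => ?_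
  simp only [Matrix.cons_val_zero, Matrix.cons_val_one, Matrix.cons_val, vertexMonomial, psiPlus, psiMinus, mul_assoc]
  congr 1
  ring

omit [NeZero M] in
/-- **The position word at `y` as a momentum sum of vertex monomials**:
`ψ⁺_{y↑}ψ⁻_{y↑}ψ⁺_{y↓}ψ⁻_{y↓} = Σ_κ (∏_i (βL²)⁻¹·conj(e^{−is_iκ_i·y})) • (vertex monomial κ)`. -/
theorem klbv_psiPos_word_eq_sum (β : ℝ) (y : SpaceTimeIdx L M) :
    psiPos L M β 0 y 0 * psiPos L M β 1 y 0 * psiPos L M β 0 y 1 * psiPos L M β 1 y 1 =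
      ∑ κ : Fin 4 → FreqMomentum L M,
        (∏ i : Fin 4, (((1 / (β * (L : ℝ) ^ 2) : ℝ) : ℂ) * conj (hubbardPlaneWave L M β ((![(((0 : Fin 1), (0 : Fin 2)), (0 : Fin 2)), ((0, 0), 1), ((0, 1), 0), ((0, 1), 1)] : Fin 4 → SectorLeg 1) i).2 (κ i) y))) • vertexMonomial L M κ := by
  unfold psiPos
  rw [klbv_fourfold_smul_sum]
  refine sum_congr rfl fun κ _ => ?_
  congr 1
  rw [Fin.prod_univ_four]
  simp

omit [NeZero M] in
/-- **The quartic kernel of the position word at `vertexLegs k`**: `(4!)⁻¹ · ∏_i (βL²)⁻¹·conj(e^{−is_ik_i·y})`. -/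
theorem klbv_kernel_psiPos_word_vertexLegs (β : ℝ) (y : SpaceTimeIdx L M) (k : Fin 4 → FreqMomentum L M) :
    kernel ℂ (psiPos L M β 0 y 0 * psiPos L M β 1 y 0 * psiPos L M β 0 y 1 * psiPos L M β 1 y 1) 4 (vertexLegs L M k) =
      (((4 : ℕ).factorial : ℚ)⁻¹ • (1 : ℂ)) *
        ∏ i : Fin 4, (((1 / (β * (L : ℝ) ^ 2) : ℝ) : ℂ) * conj (hubbardPlaneWave L M β ((![(((0 : Fin 1), (0 : Fin 2)), (0 : Fin 2)), ((0, 0), 1), ((0, 1), 0), ((0, 1), 1)] : Fin 4 → SectorLeg 1) i).2 (k i) y)) := by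
  rw [klbv_psiPos_word_eq_sum, kernel_sum]
  simp_rw [kernel_smul, vertexMonomial_eq_genProd, kernel_genProd, det_deltaMatrix_vertexLegs]
  simp_rw [mul_ite, mul_one, mul_zero]
  rw [Finset.sum_ite_eq univ k, if_pos (mem_univ k), mul_comm]

/-! ## §3 The plain position-space quartic kernel of the local vertex -/

omit [NeZero M] in
/-- Sectorised kernels are linear: scalar multiples. -/
theorem klbv_sectorisedKernel_smul {N : ℕ} (β : ℝ) (F : Fin N → FreqMomentum L M → ℂ) (r : ℂ) (G : HubbardGrassmann L M) (m : ℕ)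
    (Ω : Fin m → SectorLeg N) (x : Fin m → SpaceTimeIdx L M) :
    sectorisedKernel L M β F (r • G) m Ω x = r * sectorisedKernel L M β F G m Ω x := by
  rw [sectorisedKernel_def, sectorisedKernel_def, mul_sum]
  refine sum_congr rfl fun k _ => ?_
  rw [kernel_smul]; ring

omit [NeZero M] in
/-- Sectorised kernels are linear: finite sums. -/
theorem klbv_sectorisedKernel_sum {N : ℕ} {ι : Type*} (β : ℝ) (F : Fin N → FreqMomentum L M → ℂ) (s : Finset ι) (G : ι → HubbardGrassmann L M)
    (m : ℕ) (Ω : Fin m → SectorLeg N) (x : Fin m → SpaceTimeIdx L M) :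
    sectorisedKernel L M β F (∑ a ∈ s, G a) m Ω x = ∑ a ∈ s, sectorisedKernel L M β F (G a) m Ω x := by
  simp only [sectorisedKernel_def, kernel_sum, mul_sum]
  rw [sum_comm]

/-- **The position word at `y` is local**: its plain position kernel at the vertex pattern is
`(4!)⁻¹·(βL²)⁻⁴·|Λ|⁴·𝟙[x₀ = x₁ = x₂ = x₃ = y]` (dual orthogonality on each leg). -/
theorem klbv_positionKernel_psiPos_word_eq {β : ℝ} (hβ : β ≠ 0) (y : SpaceTimeIdx L M) (x : Fin 4 → SpaceTimeIdx L M) :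
    sectorisedKernel L M β (trivialMultiplier L M) (psiPos L M β 0 y 0 * psiPos L M β 1 y 0 * psiPos L M β 0 y 1 * psiPos L M β 1 y 1) 4 (![(((0 : Fin 1), (0 : Fin 2)), (0 : Fin 2)), ((0, 0), 1), ((0, 1), 0), ((0, 1), 1)] : Fin 4 → SectorLeg 1) x =
      (((4 : ℕ).factorial : ℚ)⁻¹ • (1 : ℂ)) * (((1 / (β * (L : ℝ) ^ 2) : ℝ) : ℂ) ^ 4 *
        (if x 0 = y ∧ x 1 = y ∧ x 2 = y ∧ x 3 = y then (Fintype.card (SpaceTimeIdx L M) : ℂ) ^ 4 else 0)) := by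
  rw [sectorisedKernel_def]
  have hterm : ∀ k : Fin 4 → FreqMomentum L M,
      (∏ i, trivialMultiplier L M ((![(((0 : Fin 1), (0 : Fin 2)), (0 : Fin 2)), ((0, 0), 1), ((0, 1), 0), ((0, 1), 1)] : Fin 4 → SectorLeg 1) i).1.1 (k i) * hubbardPlaneWave L M β ((![(((0 : Fin 1), (0 : Fin 2)), (0 : Fin 2)), ((0, 0), 1), ((0, 1), 0), ((0, 1), 1)] : Fin 4 → SectorLeg 1) i).2 (k i) (x i)) *
          kernel ℂ (psiPos L M β 0 y 0 * psiPos L M β 1 y 0 * psiPos L M β 0 y 1 * psiPos L M β 1 y 1) 4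
            (fun i => ((k i, ((![(((0 : Fin 1), (0 : Fin 2)), (0 : Fin 2)), ((0, 0), 1), ((0, 1), 0), ((0, 1), 1)] : Fin 4 → SectorLeg 1) i).1.2), ((![(((0 : Fin 1), (0 : Fin 2)), (0 : Fin 2)), ((0, 0), 1), ((0, 1), 0), ((0, 1), 1)] : Fin 4 → SectorLeg 1) i).2)) =
        (((4 : ℕ).factorial : ℚ)⁻¹ • (1 : ℂ)) * (((1 / (β * (L : ℝ) ^ 2) : ℝ) : ℂ) ^ 4 *
          ∏ i, (hubbardPlaneWave L M β ((![(((0 : Fin 1), (0 : Fin 2)), (0 : Fin 2)), ((0, 0), 1), ((0, 1), 0), ((0, 1), 1)] : Fin 4 → SectorLeg 1) i).2 (k i) (x i) * conj (hubbardPlaneWave L M β ((![(((0 : Fin 1), (0 : Fin 2)), (0 : Fin 2)), ((0, 0), 1), ((0, 1), 0), ((0, 1), 1)] : Fin 4 → SectorLeg 1) i).2 (k i) y))) := by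
    intro k
    rw [klbv_vertexPattern_legs, klbv_kernel_psiPos_word_vertexLegs]
    simp only [trivialMultiplier, one_mul]
    rw [prod_mul_distrib, prod_mul_distrib, prod_const, card_univ, Fintype.card_fin]
    ring
  simp_rw [hterm]
  rw [← mul_sum, ← mul_sum]
  congr 2
  rw [sum_prod_apply_eq_prod_sum (fun i k => hubbardPlaneWave L M β ((![(((0 : Fin 1), (0 : Fin 2)), (0 : Fin 2)), ((0, 0), 1), ((0, 1), 0), ((0, 1), 1)] : Fin 4 → SectorLeg 1) i).2 k (x i) * conj (hubbardPlaneWave L M β ((![(((0 : Fin 1), (0 : Fin 2)), (0 : Fin 2)), ((0, 0), 1), ((0, 1), 0), ((0, 1), 1)] : Fin 4 → SectorLeg 1) i).2 k y))]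
  simp_rw [klbv_sum_hubbardPlaneWave_mul_conj_dual hβ]
  rw [Fin.prod_univ_four]
  by_cases h0 : x 0 = y
  · by_cases h1 : x 1 = y
    · by_cases h2 : x 2 = y
      · by_cases h3 : x 3 = y
        · rw [if_pos h0, if_pos h1, if_pos h2, if_pos h3, if_pos ⟨h0, h1, h2, h3⟩]; ring
        · rw [if_neg h3, mul_zero, if_neg (fun h => h3 h.2.2.2)]
      · rw [if_neg h2, mul_zero, zero_mul, if_neg (fun h => h2 h.2.2.1)]
    · rw [if_neg h1, mul_zero, zero_mul, zero_mul, if_neg (fun h => h1 h.2.1)]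
  · rw [if_neg h0, zero_mul, zero_mul, zero_mul, if_neg (fun h => h0 h.1)]

/-- **The plain position-space quartic kernel of the LOCAL vertex**: with `V_loc = (U·ε_x) • Σ_y (word at y)`,
`W₄(V_loc)(x) = (U·ε_x)·(4!)⁻¹·(βL²)⁻⁴·|Λ|⁴·𝟙[x₀ = x₃ ∧ x₁ = x₃ ∧ x₂ = x₃]` — LOCAL in space AND time (`= (U/4!)·ε_x⁻³·𝟙`). -/
theorem klbv_positionKernel_hubbardInteractionLocal_eq {β : ℝ} (hβ : β ≠ 0) (U : ℝ) (x : Fin 4 → SpaceTimeIdx L M) :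
    sectorisedKernel L M β (trivialMultiplier L M) (hubbardInteractionLocal L M β U) 4 (![(((0 : Fin 1), (0 : Fin 2)), (0 : Fin 2)), ((0, 0), 1), ((0, 1), 0), ((0, 1), 1)] : Fin 4 → SectorLeg 1) x =
      ((U * imagTimeWeight β M : ℝ) : ℂ) * ((((4 : ℕ).factorial : ℚ)⁻¹ • (1 : ℂ)) * (((1 / (β * (L : ℝ) ^ 2) : ℝ) : ℂ) ^ 4 *
        (if x 0 = x 3 ∧ x 1 = x 3 ∧ x 2 = x 3 then (Fintype.card (SpaceTimeIdx L M) : ℂ) ^ 4 else 0))) := by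
  unfold hubbardInteractionLocal
  rw [klbv_sectorisedKernel_smul, klbv_sectorisedKernel_sum]
  simp_rw [klbv_positionKernel_psiPos_word_eq hβ]
  rw [← mul_sum, ← mul_sum]
  congr 3
  -- only `y = x 3` contributes
  have hcond : ∀ y : SpaceTimeIdx L M,
      (if x 0 = y ∧ x 1 = y ∧ x 2 = y ∧ x 3 = y then (Fintype.card (SpaceTimeIdx L M) : ℂ) ^ 4 else 0) =
        if x 3 = y then (if x 0 = x 3 ∧ x 1 = x 3 ∧ x 2 = x 3 then (Fintype.card (SpaceTimeIdx L M) : ℂ) ^ 4 else 0) else 0 := by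
    intro y
    by_cases h3 : x 3 = y
    · subst h3; simp
    · rw [if_neg (fun h => h3 h.2.2.2), if_neg h3]
  simp_rw [hcond]
  rw [sum_ite_eq univ (x 3), if_pos (mem_univ _)]

/-! ## §4 The plain pinned currency of the local vertex is EXACTLY `|U|/24` -/

omit [NeZero M] in
/-- Only the constant tuple is pinned at `w` and coincident (space-time version). -/
theorem klbv_sum_coincidence_spaceTime {R : Type*} [AddCommMonoid R] (q : Fin 4) (w : SpaceTimeIdx L M) (c : R) :
    ∑ z ∈ univ.filter (fun z : Fin 4 → SpaceTimeIdx L M => z q = w), (if z 0 = z 3 ∧ z 1 = z 3 ∧ z 2 = z 3 then c else 0) = c := by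
  rw [sum_filter, Finset.sum_eq_single (fun _ => w)]
  · simp
  · intro z _ hz
    by_cases hq : z q = w
    · rw [if_pos hq, if_neg]
      rintro ⟨h0, h1, h2⟩
      apply hz
      have h3 : z 3 = w := by
        rw [← hq]; fin_cases q
        · exact h0.symm
        · exact h1.symm
        · exact h2.symm
        · rfl
      funext i
      fin_cases i
      · exact h0.trans h3
      · exact h1.trans h3
      · exact h2.trans h3
      · exact h3
    · rw [if_neg hq]
  · intro h; exact absurd (mem_univ _) h

/-- **THE PLAIN PINNED CURRENCY OF THE TIME-LATTICE-LOCAL VERTEX IS `|U|/24`, UNIFORMLY IN `M`**: for every pinned leg `q`, point `y`, `L`, `M`, `0 < β`,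
`ε_x³ · Σ_{x′ : x′_q = y} ‖W₄(V_loc)(x′)‖ = |U|/24` — the control to `klbv_plainCurrency_hubbardInteraction_eq` (STRICT conservation: `(|U|/24)·Θ_M`). -/
theorem klbv_plainCurrency_hubbardInteractionLocal_eq {β : ℝ} (hβ : 0 < β) (U : ℝ) (q : Fin 4) (y : SpaceTimeIdx L M) :
    imagTimeWeight β M ^ 3 *
        ∑ x ∈ univ.filter (fun x : Fin 4 → SpaceTimeIdx L M => x q = y),
          ‖sectorisedKernel L M β (trivialMultiplier L M) (hubbardInteractionLocal L M β U) 4 (![(((0 : Fin 1), (0 : Fin 2)), (0 : Fin 2)), ((0, 0), 1), ((0, 1), 0), ((0, 1), 1)] : Fin 4 → SectorLeg 1) x‖ = |U| / 24 := by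
  have hL : (0 : ℝ) < L := by exact_mod_cast Nat.pos_of_ne_zero (NeZero.ne L)
  have hM : (0 : ℝ) < M := by exact_mod_cast Nat.pos_of_ne_zero (NeZero.ne M)
  have hε : 0 < imagTimeWeight β M := by unfold imagTimeWeight; positivity
  have hcard : (Fintype.card (SpaceTimeIdx L M) : ℝ) = 2 * M * (L : ℝ) ^ 2 := by
    rw [Fintype.card_prod, Fintype.card_fin, Fintype.card_pi, Fin.prod_const, ZMod.card]; push_cast; ring
  have h24 : (((4 : ℕ).factorial : ℚ)⁻¹ • (1 : ℂ)) = ((24 : ℂ))⁻¹ := by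
    rw [Rat.smul_one_eq_cast]; push_cast; norm_num [Nat.factorial]
  -- pointwise norm
  have hx : ∀ x : Fin 4 → SpaceTimeIdx L M,
      ‖sectorisedKernel L M β (trivialMultiplier L M) (hubbardInteractionLocal L M β U) 4 (![(((0 : Fin 1), (0 : Fin 2)), (0 : Fin 2)), ((0, 0), 1), ((0, 1), 0), ((0, 1), 1)] : Fin 4 → SectorLeg 1) x‖ =
        |U| * imagTimeWeight β M * (24⁻¹ * ((1 / (β * (L : ℝ) ^ 2)) ^ 4 *
          (if x 0 = x 3 ∧ x 1 = x 3 ∧ x 2 = x 3 then (Fintype.card (SpaceTimeIdx L M) : ℝ) ^ 4 else 0))) := by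
    intro x
    rw [klbv_positionKernel_hubbardInteractionLocal_eq hβ.ne', h24]
    rw [norm_mul, norm_mul, norm_mul, Complex.norm_real, Real.norm_eq_abs, abs_mul, abs_of_pos hε, norm_inv, norm_pow, Complex.norm_real,
      Real.norm_eq_abs, abs_of_pos (by positivity : (0 : ℝ) < 1 / (β * (L : ℝ) ^ 2))]
    congr 2
    · simp
    · congr 1
      split_ifs <;> simp
  simp_rw [hx]
  rw [← mul_sum, ← mul_sum, ← mul_sum, klbv_sum_coincidence_spaceTime, hcard, imagTimeWeight]
  have hβ0 : β ≠ 0 := hβ.ne'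
  field_simp

end Summit.HubbardSuperconductivity.HubbardSuperconductivity.Theorems.KLRegimeSplit

end
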